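import Summits.QuantumFields.YangMills.Theorems.BalabanLadderIRCofinalCouplingsBridge
import Summits.QuantumFields.YangMills.Theorems.BalabanLadderIRPinnedExitCofinal
import Summits.QuantumFields.YangMills.Theses.BalabanLadder
import HarnessLib

/-!
# Line `pinned-exit-cofinal` rev 2 (ideator ym-ir-idea-11 g0/g2, LINE 3, lens «finite», post-R423/R424):
## the X-FREE COFINAL BILL  `IRcof ⇐ PXcof(1/24) ∧ N` — ONE pinned `1/24`-pure cold box at COFINALLY MANY couplings, nothing in between
## concludes THE ROUTE DECL `Summit.QuantumFields.YangMills.Theses.BalabanLadder.IRcof` (item stmt-QuantumFields-26930, R424 (a)) BY NAME;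
## filed under crux `BalabanLadder.IR` (stmt-QuantumFields-19354, rung R2c; `IR → IRcof` proved below as `routeIRcof_of_routeIR`)

REV 2 (g2, 2026-08-28): (i) the X-free cofinal kernel (rev 1 §1) is now CITED BY NAME from the landed helper
`Theorems/BalabanLadderIRPinnedExitCofinal.lean` (p616292; `PinnedExitCofinal.cofinalGapOn_of_pinnedExits[_le]`, `ircofSC_of_pinnedExitsCofinal_le`,
`pinnedExitsCofinal_of_pinnedExitAt`) — no local copy; (ii) after R424 (a) (owner ym-beyond-p2 g33; Theses rev 12 ef4d143071be) the route carries the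
cofinal leaf as its own decl `Theses.BalabanLadder.IRcof` (item 26930); every bill below concludes THAT DECL LITERALLY, and
`IRcof_iff_route : IRcof ↔ Theses.BalabanLadder.IRcof := Iff.rfl` records that the local restatement and the route decl are one object.
Stub set unchanged {PXcof(1/24), N}; verdicts of record: crit-1 g2 VERDICT 21 PASS-WITH-PRICE (08:18:32Z); crit-3 g2 PRIMARY PASS-WITH-PRICE +
STRUCTURAL PASS (08:25:00Z; price = PXcof(1/24) = THE NUMBER, pinned + cofinal; LOCATED-B ✗ — no mechanism toward the number is claimed here).

HONEST FRAMING.  Nothing in this file proves the Yang–Mills mass gap (Clay), the crux `IR`, its cofinal leaf `IRcof`, or the existence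
of a single pure box; R4 (`BalabanUVStability4`) closes only the conditional finite-𝕋⁴ rung `BalabanLadder.UV`.  Conditional skeleton: two
`stub_*` obligations and a kernel-checked composition `IRcof_of_stubs : Summit.QuantumFields.YangMills.Theses.BalabanLadder.IRcof` (THE ROUTE DECL, item 26930, literally;
the route's `closes` takes `IRcof` to the summit with the other five leaves).  The uniform crux `IR` is NOT
concluded here (for `IR` this author's lines are `thermal-ratchet` and `fss-handover`).

THE LINE.  After R423 the summit consumes the infrared leg only on a COFINAL set of couplings (`Y2Bridge.yangMills_of_cofinalLegs`).  The leaf of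
record `K1 ∧ X ∧ N` (`cofinal-leaf`) is cofinal but spends the AF pin `X = AFToColdPressure` at EVERY large coupling (`gapOn_exitSet_of_af` via
`cp_pinned`); the slot of record `PX(1/24) ∧ N` (`pinned_exit_96_bill`, idea-14) is X-free but asks a pinned pure box at EVERY large coupling.
This line is their MEET — cofinal AND X-free:

  **PXcof(θ)** = `PinnedExitsCofinalAt θ`: for simply-connected compact simple `G`, every `r`, every positive unit map `a → 0` with the floor
  `LowerBounds G r a`: `∃ T ∀ β₁ ∃ β ≥ β₁ ∃ L ≥ 8, a(β)·L ≤ T ∧ δᶜ_β(L) ≤ θ` — ONE `θ`-pure cold `4:1` box of bounded size in floor units at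
  cofinally many couplings of the certifier's choosing; NOTHING is asked at the couplings in between (no AF pin, no heredity sign, no tameness).

  `IRcof ⇐ PXcof(1/24) ∧ N` (`ircof_of_pinnedExitsCofinal`, PROVED): at a pinned exit, idea-14's climb-to-cold-pressure
  `PinnedExit96.coldPressureAt_widen_24` (over `PurityClimb.coldDefect_widen_24`) gives `ColdPressureAt` at `2¹⁴·L`, so the cold-pressure length is
  pinned `a(β)·ξ⋆(β) ≤ 2¹⁴·T` AT THAT COUPLING; the rate seam of `cofinal-leaf` needs onset and pin ONLY on the set where it concludes
  (`gapOn_of_coldPressure_pinned_onSet` — its proof never used the pin elsewhere); the exit set is cofinal by hypothesis.  Non-simply-connected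
  `G`: `N = IRnsc` (uniform, tree) restricted to `univ`.

WHY THIS IS THE «finite» LENS END-POINT.  Each instance of PXcof is ONE finite-dimensional integral inequality (a Wilson partition-function ratio on
`L³×{⌊L/4⌋, 2⌊L/4⌋}` at one coupling) plus the bookkeeping `a(β)·L ≤ T`; the summit needs an unbounded SEQUENCE of such instances and — after
R423 and this file — NOTHING ELSE on the infrared side for `π₁ = 1`.  Reduction-to-finite theorem first (here), computation ∕ construction second
(the number: FINITE-BOX-PURITY §3, SU(2) β_W = 2.4: `L ≈ 36` at tolerance `1/24`).

RELATIONS (PROVED here or landed): PX(θ) ⇒ PXcof(θ) (`pinnedExitsCofinalAt_of_pinnedExitAt`); HER ∧ CERT ⇒ PX (landed `ThermalRatchetSeam`,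
p611594) ⇒ PXcof; PXcof(θ) monotone in θ; `IR ⇒ IRcof` (cofinal-leaf).  PXcof vs `K1 ∧ X`: incomparable as typed (PXcof pins the BOX in floor
units; X pins the cold-pressure LENGTH through asymptotic freedom at every β); both give `IRcof` with N.
WHY IT MIGHT FAIL (PXcof): as K1 — a non-abelian massless phase (false for `U(1)₄`: Guth ∕ Fröhlich–Spencer; the hypothesis `π₁ = 1` and
non-abelianness must be used) — plus the pin: the pure boxes must have bounded size in FLOOR units `a(β)` (the scale at which the two-point floor
of `LowerBounds` is observed), i.e. the confinement scale and the floor scale must be comparable along the sequence.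
CHEAPEST FALSIFIER (B2): the number itself — FINITE-BOX-PURITY §3 rows (one 96 %-pure cold 4:1 box per certified coupling); no transport row needed.
Sources: Guth1980, FrohlichSpencer1982 (U(1) sieve); Lüscher–Weisz ∕ Teper glueball-gas synthesis for the box sizes (GUIDANCE); tree: `cofinal-leaf`
(idea-12) `gapOn_of_coldPressure_pinned_on`, `Y2Bridge.yangMills_of_cofinalLegs`; `PinnedExit96` (idea-14); `PurityClimb24` (idea-11).
bears_on: R2c (19354) through the re-typed leaf `IRcof` (R423).
-/

set_option autoImplicit false

noncomputable section

open Filter Topology MeasureTheory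
open scoped SchwartzMap
open Literature.MathematicalPhysics.QuantumFieldTheory Literature.MathematicalPhysics.QuantumLattice
open Summit.QuantumFields.YangMills.Cruxes.OSLegsFromFemtoAndGap.DlrCollarTransfer (GapInUnits LowerBounds Q2)
open Summit.QuantumFields.YangMills.Theorems.WeakCouplingHypercubicLimit.TraceNormColdPressure
  (abs_latticeConnectedCorr_le_of_coldPressure)
open Summit.QuantumFields.YangMills.Cruxes.IR.FluxCodeBlindness (volumeFloor_eventually)
open Summit.QuantumFields.YangMills.Cruxes.IR.ColdPurityBridge (coldDefect)
open Summit.QuantumFields.YangMills.Cruxes.IR.ColdPressurePincer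
open Summit.QuantumFields.YangMills.Cruxes.IR.PinnedExit96 (PinnedExitAt coldPressureAt_widen_24)
open Summit.QuantumFields.YangMills.Cruxes.OSLegsAtWeakCouplingC.Y2Bridge (gapOn_univ_of_gapInUnits)

namespace Summit.QuantumFields.YangMills.Cruxes.IR.PinnedExitCofinalLine

/-! ## §0 The Props (the leaf restated by text; the line's one new obligation) -/

section Defs
variable (G : Type) [Group G] [TopologicalSpace G] [IsTopologicalGroup G] [CompactSpace G]
  [MeasurableSpace G] [BorelSpace G]

/-- `GapOn G r a Bset` — the `GapInUnits` clustering family ON THE SET OF COUPLINGS `Bset` (verbatim `cofinal-leaf`'s `CofinalLeaf.GapOn`). -/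
def GapOn (r : LatticeRep G) (a : ℝ → ℝ) (Bset : Set ℝ) : Prop :=
  ∃ (c₁ β₂ : ℝ) (S₁ : ℝ → ℕ), 0 < c₁ ∧ ∀ A B : YMSpecies G, ∃ C : ℝ, ∀ β ∈ Bset, β₂ ≤ β →
    ∀ S n : ℕ, S₁ β ≤ S → n ≤ S →
      |latticeConnectedCorr r.ρ β (2 * S + 1) A.F B.F n| ≤ C * Real.exp (-(c₁ * a β * n))

end Defs

/-- **`IRcof` — the cofinal leaf** (verbatim the ROUTE DECL `Summit.QuantumFields.YangMills.Theses.BalabanLadder.IRcof` (R424 (a)) and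
`cofinal-leaf`'s `CofinalLeaf.IRcof`; kept as a local name for readability — `IRcof_iff_route` below is `Iff.rfl`). -/
def IRcof : Prop :=
  ∀ (G : Type) [Group G] [TopologicalSpace G] [IsTopologicalGroup G] [CompactSpace G],
    IsCompactSimpleLieGroup G →
    letI : MeasurableSpace G := borel G
    haveI : BorelSpace G := ⟨rfl⟩
    ∀ (r : LatticeRep G) (a : ℝ → ℝ), (∀ β, 0 < a β) → Tendsto a atTop (𝓝 0) → LowerBounds G r a →
      ∃ Bset : Set ℝ, (∀ x : ℝ, ∃ β ∈ Bset, x ≤ β) ∧ GapOn G r a Bset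

/-- **PXcof(θ) = `PinnedExitsCofinalAt θ` — THE LINE'S ONE NEW OBLIGATION (load-bearing; «the number», cofinal, pinned in floor units).**
For simply-connected compact simple `G`, every `r`, every positive unit map `a → 0` carrying the floor `LowerBounds G r a`: there is `T` such that
for every `β₁` some coupling `β ≥ β₁` has ONE cold `4:1` torus of half-side `L ≥ 8` with `a(β)·L ≤ T` and purity defect `δᶜ_β(L) ≤ θ`. -/
def PinnedExitsCofinalAt (θ : ℝ) : Prop :=
  ∀ (G : Type) [Group G] [TopologicalSpace G] [IsTopologicalGroup G] [CompactSpace G],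
    IsCompactSimpleLieGroup G → SimplyConnectedSpace G →
    letI : MeasurableSpace G := borel G
    haveI : BorelSpace G := ⟨rfl⟩
    ∀ (r : LatticeRep G) (a : ℝ → ℝ), (∀ β, 0 < a β) → Tendsto a atTop (𝓝 0) → LowerBounds G r a →
      ∃ T : ℝ, ∀ β₁ : ℝ, ∃ β : ℝ, β₁ ≤ β ∧ ∃ L : ℕ, 8 ≤ L ∧ a β * (L : ℝ) ≤ T ∧ coldDefect r.ρ β L ≤ θ

/-- The local restatement IS the route decl (R424 (a), Theses rev 12): definitional identity. -/
theorem IRcof_iff_route : IRcof ↔ Summit.QuantumFields.YangMills.Theses.BalabanLadder.IRcof := Iff.rfl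

/-! ## §1 The X-free cofinal kernel — LANDED (`Theorems/BalabanLadderIRPinnedExitCofinal.lean`, p616292); cited by name below -/

open Summit.QuantumFields.YangMills.Cruxes.IR.PinnedExitCofinal
  (cofinalGapOn_of_pinnedExits cofinalGapOn_of_pinnedExits_le ircofSC_of_pinnedExitsCofinal_le pinnedExitsCofinal_of_pinnedExitAt)

/-! ## §2 The bill: `PXcof(1/24) ∧ N ⇒ IRcof` (PROVED), relations -/

/-- PXcof is monotone in the tolerance. -/
theorem pinnedExitsCofinalAt_mono {θ θ' : ℝ} (hθ : θ ≤ θ') (h : PinnedExitsCofinalAt θ) : PinnedExitsCofinalAt θ' := by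
  intro G _ _ _ _ hG hsc
  letI : MeasurableSpace G := borel G
  haveI : BorelSpace G := ⟨rfl⟩
  intro r a ha ha0 hlb
  obtain ⟨T, hcof⟩ := h G hG hsc r a ha ha0 hlb
  refine ⟨T, fun β₁ => ?_⟩
  obtain ⟨β, hβ, L, hL, hpin, hδ⟩ := hcof β₁
  exact ⟨β, hβ, L, hL, hpin, hδ.trans hθ⟩

/-- **PX(θ) ⇒ PXcof(θ)** — the slot of record's stub (`PinnedExit96.PinnedExitAt θ`, ALL large β) gives the cofinal form. -/
theorem pinnedExitsCofinalAt_of_pinnedExitAt {θ : ℝ} (hP : PinnedExitAt θ) : PinnedExitsCofinalAt θ :=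
  pinnedExitsCofinal_of_pinnedExitAt hP

/-- **THE BILL (PROVED) ON THE ROUTE DECL: `PXcof(1/24) ∧ N ⇒ Theses.BalabanLadder.IRcof`.**  Simply-connected `G`: the LANDED X-free
cofinal kernel `PinnedExitCofinal.cofinalGapOn_of_pinnedExits` (p616292); otherwise `N = IRnsc` gives the uniform family, restricted to `univ`
(`Y2Bridge.gapOn_univ_of_gapInUnits`). -/
theorem routeIRcof_of_pinnedExitsCofinal (hP : PinnedExitsCofinalAt (1 / 24)) (hN : IRnsc) :
    Summit.QuantumFields.YangMills.Theses.BalabanLadder.IRcof := by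
  intro G _ _ _ _ hG
  letI : MeasurableSpace G := borel G
  haveI : BorelSpace G := ⟨rfl⟩
  intro r a ha ha0 hlb
  by_cases hsc : SimplyConnectedSpace G
  · obtain ⟨T, hcof⟩ := hP G hG hsc r a ha ha0 hlb
    exact cofinalGapOn_of_pinnedExits r a ha ha0 hcof
  · exact ⟨Set.univ, fun x => ⟨x, Set.mem_univ _, le_rfl⟩, gapOn_univ_of_gapInUnits r a (hN G hG hsc r a ha ha0 hlb)⟩

/-- The same bill read on the local name (definitionally the route decl). -/
theorem ircof_of_pinnedExitsCofinal (hP : PinnedExitsCofinalAt (1 / 24)) (hN : IRnsc) : IRcof :=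
  IRcof_iff_route.2 (routeIRcof_of_pinnedExitsCofinal hP hN)

/-- The simply-connected half alone, through the landed `ircofSC_of_pinnedExitsCofinal_le` (any `θ ≤ 1/24`). -/
theorem ircofSC_of_pinnedExitsCofinalAt {θ : ℝ} (hθ : θ ≤ 1 / 24) (hP : PinnedExitsCofinalAt θ) :
    ∀ (G : Type) [Group G] [TopologicalSpace G] [IsTopologicalGroup G] [CompactSpace G],
      IsCompactSimpleLieGroup G → SimplyConnectedSpace G →
      letI : MeasurableSpace G := borel G
      haveI : BorelSpace G := ⟨rfl⟩
      ∀ (r : LatticeRep G) (a : ℝ → ℝ), (∀ β, 0 < a β) → Tendsto a atTop (𝓝 0) → LowerBounds G r a →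
        ∃ Bset : Set ℝ, (∀ x : ℝ, ∃ β ∈ Bset, x ≤ β) ∧ GapOn G r a Bset :=
  ircofSC_of_pinnedExitsCofinal_le hθ hP

/-- The bill at any tolerance `θ ≤ 1/24`, on the route decl. -/
theorem routeIRcof_of_pinnedExitsCofinal_le {θ : ℝ} (hθ : θ ≤ 1 / 24) (hP : PinnedExitsCofinalAt θ) (hN : IRnsc) :
    Summit.QuantumFields.YangMills.Theses.BalabanLadder.IRcof :=
  routeIRcof_of_pinnedExitsCofinal (pinnedExitsCofinalAt_mono hθ hP) hN

/-- The bill at any tolerance `θ ≤ 1/24` (local name). -/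
theorem ircof_of_pinnedExitsCofinal_le {θ : ℝ} (hθ : θ ≤ 1 / 24) (hP : PinnedExitsCofinalAt θ) (hN : IRnsc) : IRcof :=
  IRcof_iff_route.2 (routeIRcof_of_pinnedExitsCofinal_le hθ hP hN)

/-- **The slot of record on 19354 closes the route's cofinal leaf X-free** (through this line): `PX(1/24) ∧ N ⇒ Theses.BalabanLadder.IRcof`. -/
theorem routeIRcof_of_pinnedExitAt24 (hP : PinnedExitAt (1 / 24)) (hN : IRnsc) :
    Summit.QuantumFields.YangMills.Theses.BalabanLadder.IRcof :=
  routeIRcof_of_pinnedExitsCofinal (pinnedExitsCofinalAt_of_pinnedExitAt hP) hN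

/-- (local name) `PX(1/24) ∧ N ⇒ IRcof`. -/
theorem ircof_of_pinnedExitAt24 (hP : PinnedExitAt (1 / 24)) (hN : IRnsc) : IRcof :=
  IRcof_iff_route.2 (routeIRcof_of_pinnedExitAt24 hP hN)

/-- **The uniform crux still supplies the leaf**: `Theses.BalabanLadder.IR ⇒ Theses.BalabanLadder.IRcof` (take `Bset = univ`). -/
theorem routeIRcof_of_routeIR (hIR : Summit.QuantumFields.YangMills.Theses.BalabanLadder.IR) :
    Summit.QuantumFields.YangMills.Theses.BalabanLadder.IRcof := by
  intro G _ _ _ _ hG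
  letI : MeasurableSpace G := borel G
  haveI : BorelSpace G := ⟨rfl⟩
  intro r a ha ha0 hlb
  exact ⟨Set.univ, fun x => ⟨x, Set.mem_univ _, le_rfl⟩, gapOn_univ_of_gapInUnits r a (hIR G hG r a ha ha0 hlb)⟩

/-! ## §3 Registered stubs (the obligations; `sorry` ONLY here) and the composition by name -/

/-- stub PXcof(1/24) — ONE pinned `1/24`-pure cold `4:1` box at cofinally many couplings (load-bearing; «the number»; E-type Yang–Mills content,
false for `U(1)₄`; instrument class: decidable one-box certificates, FINITE-BOX-PURITY §3). -/
theorem stub_pinnedExitsCofinal : PinnedExitsCofinalAt (1 / 24) := by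
  sorry

/-- stub N — the `π₁(G) ≠ 1` half of the infrared leg BY NAME (`ColdPressurePincer.IRnsc`; residual token of record). -/
theorem stub_irnsc : IRnsc := by
  sorry

/-- **THE ROUTE DECL BY NAME from the registered stubs** (X-free, sign-free, cofinal): item stmt-QuantumFields-26930 literally. -/
theorem IRcof_of_stubs : Summit.QuantumFields.YangMills.Theses.BalabanLadder.IRcof :=
  routeIRcof_of_pinnedExitsCofinal stub_pinnedExitsCofinal stub_irnsc

/-- (local name, definitionally the same statement). -/
theorem IRcof_local_of_stubs : IRcof :=
  IRcof_iff_route.2 IRcof_of_stubs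

end Summit.QuantumFields.YangMills.Cruxes.IR.PinnedExitCofinalLine

end
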